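import Mathlib.Tactic
import HarnessLib

/-!
# The unique non-bounding Weierstrass monomial and exactness of the coordinate valuations

Kernel leaf for the W1 census line of cell `pub-hsemireg` (seat w1-cx-1 gen 12, note
`widen/W1/TOPEND-w1cx1.md` §2, LEMMAS (L2′)/(L2″)): the arithmetic core of «in the two-chart Čech complex of
the affine Weierstrass cubic `y² = x³ − 1` with cover `U₀ = E ∖ o`, `U₁ = {y ≠ 0}` and monomial basis
`xⁱ yʲ` (`i ∈ {0,1,2}`, `j ∈ ℤ`), every monomial except `x²/y` is a section on `U₀` (`j ≥ 0`) or on `U₁`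
(pole order `2i + 3j ≤ 0` at `o`), so the cohomology reading is the coefficient of `x²/y`» and of «the
order at `o`, `-(2i+3j)`, separates the basis monomials, so coordinate valuations of numerators are exact minima».

We prove, for natural `i ≤ 2` and integer `j`:
* `nonBounding_iff`: `¬ (0 ≤ j) ∧ ¬ (2i + 3j ≤ 0) ↔ i = 2 ∧ j = -1`;
* `weight_injective`: `2i + 3j = 2i' + 3j'` with `i, i' ≤ 2` forces `i = i'` and `j = j'`;
* `weight_eq_one_iff`: `2i + 3j = 1 ↔ i = 2 ∧ j = -1` (the residue monomial is the unique one of pole order 1);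
* `bounding_trichotomy`: every basis monomial is regular on `U₀`, or regular at `o`, or is `x²/y` (the case split behind (L2″));
* `weight_add`: orders at `o` add under products (the bookkeeping behind (L3′)).

Honest framing: elementary arithmetic (theorems only); nothing here bears on HC / HC_CM / HC_AV.
-/

namespace Summit.Ventures.HSemireg.NonBoundingMonomial

/-- A basis monomial `xⁱyʲ` (`i ≤ 2`) lies on neither chart — not regular on `U₀` (`j < 0`) and of positive
pole order at `o` (`2i + 3j > 0`) — iff it is `x²/y`. -/
theorem nonBounding_iff (i : ℕ) (j : ℤ) (hi : i ≤ 2) :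
    (¬ (0 ≤ j) ∧ ¬ (2 * (i : ℤ) + 3 * j ≤ 0)) ↔ (i = 2 ∧ j = -1) := by
  constructor
  · rintro ⟨hj, hw⟩
    push Not at hj hw
    interval_cases i <;> omega
  · rintro ⟨rfl, rfl⟩
    norm_num

/-- The weight `2i + 3j` (minus the order at `o`) separates the basis monomials with `i ≤ 2`. -/
theorem weight_injective (i i' : ℕ) (j j' : ℤ) (hi : i ≤ 2) (hi' : i' ≤ 2)
    (h : 2 * (i : ℤ) + 3 * j = 2 * (i' : ℤ) + 3 * j') : i = i' ∧ j = j' := by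
  interval_cases i <;> interval_cases i' <;> omega

/-- The residue monomial `x²/y` is the unique basis monomial of weight `1` (pole order one at `o`). -/
theorem weight_eq_one_iff (i : ℕ) (j : ℤ) (hi : i ≤ 2) :
    2 * (i : ℤ) + 3 * j = 1 ↔ (i = 2 ∧ j = -1) := by
  constructor
  · intro h
    interval_cases i <;> omega
  · rintro ⟨rfl, rfl⟩
    norm_num

/-- Dichotomy used for the degree-2 reading (L2″): a basis monomial is regular on `U₀`, or regular at `o`
(hence a section on `U₁`), or it is `x²/y`. -/
theorem bounding_trichotomy (i : ℕ) (j : ℤ) (hi : i ≤ 2) :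
    0 ≤ j ∨ 2 * (i : ℤ) + 3 * j ≤ 0 ∨ (i = 2 ∧ j = -1) := by
  by_cases hj : 0 ≤ j
  · exact Or.inl hj
  · by_cases hw : 2 * (i : ℤ) + 3 * j ≤ 0
    · exact Or.inr (Or.inl hw)
    · exact Or.inr (Or.inr ((nonBounding_iff i j hi).mp ⟨hj, hw⟩))

/-- Valuations add and slacks add: the order at `o` of a product of monomials is the sum of the orders
(the trivial bookkeeping behind (L3′); stated for the weights). -/
theorem weight_add (i i' : ℤ) (j j' : ℤ) :
    2 * (i + i') + 3 * (j + j') = (2 * i + 3 * j) + (2 * i' + 3 * j') := by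
  ring

end Summit.Ventures.HSemireg.NonBoundingMonomial
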